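import Literature.AlgebraicGeometry.Motives.AbelianVarietyAmpleProofs
import Literature.AlgebraicGeometry.Motives.AbelianVarietyWeilPairingRadical
import Literature.AlgebraicGeometry.Motives.AlgPointsFiniteFibres
import Literature.AlgebraicGeometry.Morphisms.FiniteOfClosedFibres
import Mathlib.Topology.NoetherianSpace
import HarnessLib

/-!
# A proper morphism on an abelian variety whose closed fibres sit in translates of `A ∖ Supp D` is finite, when only
# finitely many translations stabilise `Supp D` (Mumford, *Abelian Varieties*, §6 Application 1, p. 61 — finiteness half)

Layer `Literature/AlgebraicGeometry/Motives`, namespaces `Literature.AlgebraicGeometry.Motives` (§1, topology) and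
`Literature.AlgebraicGeometry.Motives.AbelianVariety` (§2–§3).  KERNEL ONLY: theorems; no definition, no named fact, no instance,
no `sorry`.  Brick (F) of the cell `hodgecm-mathlib` (D-0151) road G5 (V7-c) = Mumford §6 Application 1 «an effective divisor `D`
on an abelian variety with finite `K(D)` is ample», finiteness half (V7-c-ii) (lead A-p06 (g16)); the TRANSLATION LEMMA (H)
«an irreducible closed `Z` inside one translate of `A ∖ Supp D` gives `t_{z z′⁻¹}(Supp D) = Supp D` for all `z, z′ ∈ Z(k)`»
(Mumford p. 61) is a sibling file and enters here as the explicit hypothesis `hH` (its letter verbatim), to be discharged by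
import when it lands.

## The argument ([MumfordAV1970] §6, proof of Application 1, p. 61)

Let `φ : A → P` be proper to a Jacobson scheme, such that every closed fibre `φ⁻¹(p)` lies in SOME translate `t_y⁻¹(A ∖ Supp D)`
(for the morphism of the linear system `|2D|` this is base-point freeness: `φ⁻¹ D₊(x_i) = t_{y_i}⁻¹U ∩ t_{y_i⁻¹}⁻¹U`).  If a
closed fibre `F` were infinite, it would contain an irreducible closed `Z` with infinitely many `k`-points (`A` is Noetherian and
Jacobson; §1–§2); by (H) every `z z₀⁻¹`, `z ∈ Z(k)`, stabilises `Supp D`, and `z ↦ z z₀⁻¹` is injective — contradicting the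
finiteness of the stabiliser.  So all closed fibres are finite and `φ`, being proper, is finite
(★ `Morphisms.isFinite_of_isProper_of_finite_preimage_closedPoint`).

* §1 `exists_isIrreducible_infinite_subset_of_isClosed` — an infinite closed subset of a Noetherian space contains an infinite
  irreducible closed subset (finitely many irreducible components).
* §2 `AbelianVariety.infinite_setOf_pt_mem` — an infinite closed subset of an abelian variety over `k = k̄` carries infinitely many
  `k`-points (★ `Set.Finite.of_isClosed_of_finite_inter_closedPoints`, ★ `AlgPoints.exists_pt_eq_of_isClosed_singleton`).
* §3 **`AbelianVariety.isFinite_of_preimage_subset_translate_of_translationLemma`** (letter (F) with (H) as hypothesis) and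
  **`AbelianVariety.isFinite_of_preimage_subset_translate_of_finite_KTheta_of_lemmas`** (the stabiliser bounded by `K(D)(k)` through
  (H)'s transfer head, also a hypothesis).

COUNT-NEUTRAL.  HC_CM is proved only modulo the 7 printed citations until rung 0 closes.

## References
* [MumfordAV1970] D. Mumford, *Abelian Varieties* (1970), §6 Application 1 and its proof (pp. 60–61).
* [GortzWedhorn2020] U. Görtz, T. Wedhorn, *Algebraic Geometry I*, 2nd ed. (2020), Section (3.13) and Prop. 3.35 (Jacobson schemes,
  very dense closed points).
-/

set_option autoImplicit false

noncomputable section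

universe u

open CategoryTheory AlgebraicGeometry TopologicalSpace

namespace Literature.AlgebraicGeometry.Motives

/-! ## §1 Topology: an infinite closed set in a Noetherian space has an infinite irreducible closed subset -/

/-- **An infinite closed subset of a Noetherian space contains an infinite irreducible closed subset** (it is a finite union
of irreducible closed subsets, Mathlib `NoetherianSpace.exists_finite_set_closeds_irreducible`).
[cite: GortzWedhorn2020, Section (3.13) and Prop. 3.35] -/
theorem exists_isIrreducible_infinite_subset_of_isClosed {X : Type*} [TopologicalSpace X] [NoetherianSpace X]
    {F : Set X} (hF : IsClosed F) (hinf : F.Infinite) :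
    ∃ Z : Set X, Z ⊆ F ∧ IsClosed Z ∧ IsIrreducible Z ∧ Z.Infinite := by
  obtain ⟨S, hSfin, hSirr, hFS⟩ := NoetherianSpace.exists_finite_set_closeds_irreducible (⟨F, hF⟩ : Closeds X)
  have hFeq : F = ⋃ t ∈ S, (t : Set X) := by
    have h := congrArg (fun s : Closeds X => (s : Set X)) hFS
    simp only [Closeds.coe_mk, Closeds.coe_sSup, Set.sUnion_image] at h
    rw [h]
    exact (Set.Finite.isClosed_biUnion hSfin fun t _ => t.isClosed).closure_eq
  by_contra hcon
  apply hinf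
  rw [hFeq]
  refine Set.Finite.biUnion hSfin fun t ht => ?_
  by_contra htinf
  exact hcon ⟨t, hFeq ▸ Set.subset_biUnion_of_mem ht, t.isClosed, hSirr t ht, htinf⟩

/-! ## §2 Infinite closed subsets of an abelian variety carry infinitely many rational points (`k = k̄`) -/

namespace AbelianVariety

variable {k : Type u} [Field k] [IsAlgClosed k] (A : AbelianVariety k)

/-- **An infinite closed subset `Z` of an abelian variety over an algebraically closed field contains infinitely many
`k`-points** (`A` is Jacobson, so the closed points of `Z` are infinite — ★ `Set.Finite.of_isClosed_of_finite_inter_closedPoints` —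
and closed points are points of `k`-points, ★ `AlgPoints.exists_pt_eq_of_isClosed_singleton`).
[cite: GortzWedhorn2020, Section (3.13) and Prop. 3.35] -/
theorem infinite_setOf_pt_mem {Z : Set A.X.left} (hZ : IsClosed Z) (hinf : Z.Infinite) :
    {z : A.Points k | z.pt ∈ Z}.Infinite := by
  haveI := A.jacobsonSpace_left
  intro hfin
  apply hinf
  refine Set.Finite.of_isClosed_of_finite_inter_closedPoints hZ ?_
  refine (hfin.image fun z : A.Points k => z.pt).subset ?_
  rintro x ⟨hxZ, hxcl⟩
  obtain ⟨z, rfl⟩ := AlgPoints.exists_pt_eq_of_isClosed_singleton (X := A.X) (mem_closedPoints_iff.mp hxcl)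
  exact ⟨z, hxZ, rfl⟩

/-! ## §3 The finiteness half of Mumford §6 Application 1, granted the translation lemma (H) -/

variable (D : CartierDivisor A.X.left)

/-- **Letter (F) of the road G5 (V7-c-ii), with the translation lemma (H) as the hypothesis `hH`.**  Let `D` be a Cartier divisor
on the abelian variety `A` over `k = k̄`, `U := A ∖ Supp D` (`D.nonvanishing 1`), such that only finitely many `x ∈ A(k)` satisfy
`t_x(Supp D) = Supp D`, and let `φ : A → P` be PROPER to a Jacobson scheme with every closed fibre inside some translate
`t_y⁻¹ U`.  GRANTED (H) «an irreducible closed `Z ⊆ t_y⁻¹U` has `t_{z z′⁻¹}(Supp D) = Supp D` for all `z, z′ ∈ Z(k)`», the morphism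
`φ` is FINITE: an infinite closed fibre would contain an irreducible closed `Z` with infinitely many `k`-points (§1, §2), and
`z ↦ z z₀⁻¹` would inject `Z(k)` into the finite stabiliser. [cite: MumfordAV1970, §6 Application 1 and its proof (pp. 60–61)] -/
theorem isFinite_of_preimage_subset_translate_of_translationLemma
    (hH : ∀ (Z : Set A.X.left), IsClosed Z → IsIrreducible Z → ∀ (y : A.Points k),
      Z ⊆ (A.translation y).left.base ⁻¹' (D.nonvanishing 1) → ∀ (z z' : A.Points k), z.pt ∈ Z → z'.pt ∈ Z →
        (A.translation (z * z'⁻¹)).left.base '' (D.nonvanishing 1)ᶜ = (D.nonvanishing 1)ᶜ)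
    (hstab : {x : A.Points k | (A.translation x).left.base '' (D.nonvanishing 1)ᶜ = (D.nonvanishing 1)ᶜ}.Finite)
    {P : Scheme.{u}} (φ : A.X.left ⟶ P) [IsProper φ] [JacobsonSpace P]
    (hcov : ∀ p : P, IsClosed ({p} : Set P) →
      ∃ y : A.Points k, φ.base ⁻¹' {p} ⊆ (A.translation y).left.base ⁻¹' (D.nonvanishing 1)) :
    IsFinite φ := by
  haveI : IsNoetherian A.X.left := A.isNoetherian_left
  refine Morphisms.isFinite_of_isProper_of_finite_preimage_closedPoint φ fun p hp => ?_
  by_contra hinf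
  -- an irreducible closed `Z` inside the fibre with infinitely many `k`-points
  obtain ⟨Z, hZF, hZc, hZi, hZinf⟩ :=
    exists_isIrreducible_infinite_subset_of_isClosed (hp.preimage φ.base.hom.continuous) hinf
  obtain ⟨y, hy⟩ := hcov p hp
  have hZy : Z ⊆ (A.translation y).left.base ⁻¹' (D.nonvanishing 1) := hZF.trans hy
  have hk : {z : A.Points k | z.pt ∈ Z}.Infinite := A.infinite_setOf_pt_mem hZc hZinf
  obtain ⟨z₀, hz₀⟩ := hk.nonempty
  -- `z ↦ z z₀⁻¹` injects `Z(k)` into the finite stabiliser of `Supp D`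
  refine hk ((hstab.preimage ((mul_left_injective z₀⁻¹).injOn)).subset fun z hz => ?_)
  exact hH Z hZc hZi y hZy z z₀ hz hz₀

/-- **The same with the stabiliser bounded by `K(D)(k)`** — granted, besides (H), its TRANSFER head «`t_x(Supp D) = Supp D ⇒ x ∈ K(D)`»
(`hT`; for an irreducible support with multiplicity one ∕ prime `D`, Mumford p. 61): if `K(D)(k)` is finite, `φ` is finite.  The
shape consumed by the VI-7 closer (`K(Θ_W) = ⊥`). [cite: MumfordAV1970, §6 Application 1 and its proof (pp. 60–61)] -/
theorem isFinite_of_preimage_subset_translate_of_finite_KTheta_of_lemmas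
    (hH : ∀ (Z : Set A.X.left), IsClosed Z → IsIrreducible Z → ∀ (y : A.Points k),
      Z ⊆ (A.translation y).left.base ⁻¹' (D.nonvanishing 1) → ∀ (z z' : A.Points k), z.pt ∈ Z → z'.pt ∈ Z →
        (A.translation (z * z'⁻¹)).left.base '' (D.nonvanishing 1)ᶜ = (D.nonvanishing 1)ᶜ)
    (hT : ∀ x : A.Points k, (A.translation x).left.base '' (D.nonvanishing 1)ᶜ = (D.nonvanishing 1)ᶜ → x ∈ A.KTheta D)
    (hK : (A.KTheta D : Set (A.Points k)).Finite)
    {P : Scheme.{u}} (φ : A.X.left ⟶ P) [IsProper φ] [JacobsonSpace P]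
    (hcov : ∀ p : P, IsClosed ({p} : Set P) →
      ∃ y : A.Points k, φ.base ⁻¹' {p} ⊆ (A.translation y).left.base ⁻¹' (D.nonvanishing 1)) :
    IsFinite φ :=
  A.isFinite_of_preimage_subset_translate_of_translationLemma D hH (hK.subset fun x hx => hT x hx) φ hcov

/-- The `K(D) = ⊥` spelling (the G5 socket `stub_V7c` carries `hK : A.KTheta D = ⊥`). [cite: MumfordAV1970, §6 Application 1 and its proof (pp. 60–61)] -/
theorem isFinite_of_preimage_subset_translate_of_KTheta_eq_bot_of_lemmas
    (hH : ∀ (Z : Set A.X.left), IsClosed Z → IsIrreducible Z → ∀ (y : A.Points k),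
      Z ⊆ (A.translation y).left.base ⁻¹' (D.nonvanishing 1) → ∀ (z z' : A.Points k), z.pt ∈ Z → z'.pt ∈ Z →
        (A.translation (z * z'⁻¹)).left.base '' (D.nonvanishing 1)ᶜ = (D.nonvanishing 1)ᶜ)
    (hT : ∀ x : A.Points k, (A.translation x).left.base '' (D.nonvanishing 1)ᶜ = (D.nonvanishing 1)ᶜ → x ∈ A.KTheta D)
    (hK : A.KTheta D = ⊥)
    {P : Scheme.{u}} (φ : A.X.left ⟶ P) [IsProper φ] [JacobsonSpace P]
    (hcov : ∀ p : P, IsClosed ({p} : Set P) →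
      ∃ y : A.Points k, φ.base ⁻¹' {p} ⊆ (A.translation y).left.base ⁻¹' (D.nonvanishing 1)) :
    IsFinite φ :=
  A.isFinite_of_preimage_subset_translate_of_finite_KTheta_of_lemmas D hH hT
    (by rw [hK]; exact (Set.finite_singleton (1 : A.Points k)).subset fun x hx => (Subgroup.mem_bot.mp hx : x = 1) ▸ rfl)
    φ hcov

end AbelianVariety

end Literature.AlgebraicGeometry.Motives

end
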